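import Mathlib
import HarnessLib

/-!
# `NoHeavyLowerTail` (stmt-CriticalPhenomena-4575) — universal goodness at `|A| = 3`: the real algebra of the
# reduction R3 (helpers and the case "lowest"; cases "middle"/"top" in `…KNGoodR3Cases.lean`)

Support file (`--supports stmt-CriticalPhenomena-4575`, hull-port prover `prim-hp-2`, gen 21).  No definitions, no named
facts, no sorries; pure real arithmetic (no percolation).

Setting (prim-hp-2 MEMO-gen12 §6 / MEMO-gen21 §4).  For a separated Kozma–Nitzan quadruple with relays `1,2,3` labelled by
their `T`-side reliabilities `s₁ ≤ s₂ ≤ s₃`, put `α = s₂−s₁`, `β = s₃−s₂`, `γ = s₁₃−t₂`, `δ = s₂₃−t₁`, `ε = s₁₂−t₃`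
(`α, β, δ ≥ 0`; `γ, ε` free).  The B-side enters through the world masses `Q_d, Q₁₂, Q₁₃, Q₂₃`, the cell masses
`m(σ, S_o)` and, for every hairless pocket `i`, the masses `p_σ(i) = μ(C(o) = W_i, σ)`.  The goodness slack at the
loneliest relay `c` is `Q7part(c) − Σ_i max_a L_{i,a}` (a linear form minus a sum of maxima of linear forms), the two
loneliness rows of `c` are linear constraints, and the B-side supplies the TWO-WORLD INEQUALITIES (tree:
`KNGoodB3.two_world`, from the pocket-augmented BHK theorem) for every pocket family `𝒬`:
`Q_{ab}·(m(d,a)+m(d,b)+Σ_𝒬 p_d) ≤ Q_d·(m(ab,ab)+Σ_𝒬 p_{ab})` and `Q_d·(m(ab,c)+Σ_𝒬 p_{ab}) ≤ Q_{ab}·(m(d,c)+Σ_𝒬 p_d)`.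

* `KNGoodR3.sum_max_split` — `Σ_i max(0, f i, g i) = Σ_{𝒬_f} f + Σ_{𝒬_g} g` for the two argmax families.
* `KNGoodR3.case_low`, `KNGoodR3.case_mid`, `KNGoodR3.case_top` — **the slack is nonnegative** when the loneliest relay
  is the `T`-lowest / middle / top one.  Each: pick the argmax families, apply three two-world inequalities, eliminate
  `γ, ε` with the loneliness rows by sign (no division: multiply by world masses; null worlds have null cells).
[cite: KozmaNitzan2024, §3.2 (p. 12), proof of Thm. 3 (pp. 10–12)]
-/

namespace Summit.CriticalPhenomena.PercolationContinuityZ3.Theorems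

namespace KNGoodR3

open Finset

variable {ι : Type*} [Fintype ι]

/-- `max(0, a, b)` splits according to which of `a, b` is the (first) nonnegative maximum. [folklore] -/
theorem max_split (a b : ℝ) :
    max 0 (max a b) = (if 0 ≤ a ∧ b ≤ a then a else 0) + (if 0 ≤ b ∧ a < b then b else 0) := by
  rcases le_or_gt b a with hba | hab
  · -- `max a b = a`
    have hn : ¬ (0 ≤ b ∧ a < b) := fun h => absurd h.2 (not_lt.2 hba)
    rw [max_eq_left hba, if_neg hn, add_zero]
    rcases le_or_gt 0 a with ha | ha
    · rw [if_pos ⟨ha, hba⟩, max_eq_right ha]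
    · have hn' : ¬ (0 ≤ a ∧ b ≤ a) := fun h => absurd h.1 (not_le.2 ha)
      rw [if_neg hn', max_eq_left ha.le]
  · -- `max a b = b`
    have hn : ¬ (0 ≤ a ∧ b ≤ a) := fun h => absurd h.2 (not_le.2 hab)
    rw [max_eq_right hab.le, if_neg hn, zero_add]
    rcases le_or_gt 0 b with hb | hb
    · rw [if_pos ⟨hb, hab⟩, max_eq_right hb]
    · have hn' : ¬ (0 ≤ b ∧ a < b) := fun h => absurd h.1 (not_le.2 hb)
      rw [if_neg hn', max_eq_left hb.le]

/-- **Splitting a sum of maxima along the argmax families.** [folklore] -/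
theorem sum_max_split [DecidableEq ι] (f g : ι → ℝ) :
    ∑ i, max 0 (max (f i) (g i)) =
      ∑ i ∈ univ.filter (fun i => 0 ≤ f i ∧ g i ≤ f i), f i + ∑ i ∈ univ.filter (fun i => 0 ≤ g i ∧ f i < g i), g i := by
  classical
  rw [Finset.sum_filter, Finset.sum_filter, ← Finset.sum_add_distrib]
  exact Finset.sum_congr rfl fun i _ => max_split (f i) (g i)

/-- The two argmax families are disjoint. [folklore] -/
theorem disjoint_split [DecidableEq ι] (f g : ι → ℝ) :
    Disjoint (univ.filter fun i => 0 ≤ f i ∧ g i ≤ f i) (univ.filter fun i => 0 ≤ g i ∧ f i < g i) := by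
  rw [Finset.disjoint_filter]
  intro i _ h1 h2
  exact absurd h1.2 (not_le.2 h2.2)

/-- From `0 ≤ Q · X` and `0 < Q` conclude `0 ≤ X`. [folklore] -/
theorem nonneg_of_mul_pos {Q X : ℝ} (hQ : 0 < Q) (h : 0 ≤ Q * X) : 0 ≤ X := by
  by_contra hX
  have : Q * X < 0 := mul_neg_of_pos_of_neg hQ (lt_of_not_ge hX)
  linarith

/-- A nonnegative quantity below a zero bound vanishes (used for the cells of null worlds). [folklore] -/
theorem eq_zero_of_le_zero {x B : ℝ} (hx : 0 ≤ x) (hxB : x ≤ B) (hB : B = 0) : x = 0 := by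
  rw [hB] at hxB; exact le_antisymm hxB hx

section CaseLow

variable [DecidableEq ι]

/-- **CASE c = the `T`-lowest relay** (relays labelled `1 ≤_T 2 ≤_T 3`, relay `1` is the loneliest of `G`).
The goodness slack `α m(d,2) + (α+β) m(d,3) − ε m(12,3) − γ m(13,2) + δ m(23,23) − Σ_i max(0, L_{i,2}, L_{i,3})`,
`L_{i,2} = −α p_d + γ p₁₃ − δ p₂₃`, `L_{i,3} = −(α+β) p_d + ε p₁₂ − δ p₂₃`, is `≥ 0`.
[cite: KozmaNitzan2024, §3.2 (p. 12), proof of Thm. 3 (pp. 10–12)] -/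
theorem case_low (α β γ δ ε Qd Q12 Q13 Q23 md2 md3 m12_3 m13_2 m23_23 : ℝ) (pd p12 p13 p23 : ι → ℝ)
    (hα : 0 ≤ α) (hβ : 0 ≤ β) (hδ : 0 ≤ δ)
    (hQd : 0 ≤ Qd) (hQ12 : 0 ≤ Q12) (hQ13 : 0 ≤ Q13) (hQ23 : 0 ≤ Q23)
    (hmd2 : 0 ≤ md2) (hmd3 : 0 ≤ md3) (hm12_3 : 0 ≤ m12_3) (hm13_2 : 0 ≤ m13_2) (hm23_23 : 0 ≤ m23_23)
    (hpd : ∀ i, 0 ≤ pd i) (hp12 : ∀ i, 0 ≤ p12 i) (hp13 : ∀ i, 0 ≤ p13 i) (hp23 : ∀ i, 0 ≤ p23 i)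
    -- cells of a world are bounded by its mass
    (hTd : ∀ 𝒬 : Finset ι, md2 + md3 + ∑ i ∈ 𝒬, pd i ≤ Qd)
    (hT12 : ∀ 𝒬 : Finset ι, m12_3 + ∑ i ∈ 𝒬, p12 i ≤ Q12)
    (hT13 : ∀ 𝒬 : Finset ι, m13_2 + ∑ i ∈ 𝒬, p13 i ≤ Q13)
    (hT23 : ∀ 𝒬 : Finset ι, m23_23 + ∑ i ∈ 𝒬, p23 i ≤ Q23)
    -- degenerate worlds: if `d` is null, two relays are a.s. glued and two glued worlds are null
    (hdeg : Qd = 0 → (Q12 = 0 ∧ Q13 = 0) ∨ (Q12 = 0 ∧ Q23 = 0) ∨ (Q13 = 0 ∧ Q23 = 0))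
    -- the two-world inequalities used
    (hI13a : ∀ 𝒬 : Finset ι, Qd * (m13_2 + ∑ i ∈ 𝒬, p13 i) ≤ Q13 * (md2 + ∑ i ∈ 𝒬, pd i))
    (hI12a : ∀ 𝒬 : Finset ι, Qd * (m12_3 + ∑ i ∈ 𝒬, p12 i) ≤ Q12 * (md3 + ∑ i ∈ 𝒬, pd i))
    (hI23b : ∀ 𝒬 : Finset ι, Q23 * (md2 + md3 + ∑ i ∈ 𝒬, pd i) ≤ Qd * (m23_23 + ∑ i ∈ 𝒬, p23 i))
    -- the loneliness rows of relay 1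
    (H2 : Q13 * γ ≤ Qd * α + Q23 * δ) (H3 : Q12 * ε ≤ Qd * (α + β) + Q23 * δ) :
    0 ≤ α * md2 + (α + β) * md3 - ε * m12_3 - γ * m13_2 + δ * m23_23 -
      ∑ i, max 0 (max (-α * pd i + γ * p13 i - δ * p23 i) (-(α + β) * pd i + ε * p12 i - δ * p23 i)) := by
  set L2 : ι → ℝ := fun i => -α * pd i + γ * p13 i - δ * p23 i with hL2
  set L3 : ι → ℝ := fun i => -(α + β) * pd i + ε * p12 i - δ * p23 i with hL3
  set Q2 := univ.filter (fun i => 0 ≤ L2 i ∧ L3 i ≤ L2 i) with hQ2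
  set Q3 := univ.filter (fun i => 0 ≤ L3 i ∧ L2 i < L3 i) with hQ3
  have hsplit : ∑ i, max 0 (max (L2 i) (L3 i)) = ∑ i ∈ Q2, L2 i + ∑ i ∈ Q3, L3 i := sum_max_split L2 L3
  have hdis : Disjoint Q2 Q3 := disjoint_split L2 L3
  have e2 : ∑ i ∈ Q2, L2 i = -α * (∑ i ∈ Q2, pd i) + γ * (∑ i ∈ Q2, p13 i) - δ * (∑ i ∈ Q2, p23 i) := by
    simp only [hL2, Finset.sum_add_distrib, Finset.sum_sub_distrib, ← Finset.mul_sum]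
  have e3 : ∑ i ∈ Q3, L3 i = -(α + β) * (∑ i ∈ Q3, pd i) + ε * (∑ i ∈ Q3, p12 i) - δ * (∑ i ∈ Q3, p23 i) := by
    simp only [hL3, Finset.sum_add_distrib, Finset.sum_sub_distrib, ← Finset.mul_sum]
  show 0 ≤ α * md2 + (α + β) * md3 - ε * m12_3 - γ * m13_2 + δ * m23_23 - ∑ i, max 0 (max (L2 i) (L3 i))
  rw [hsplit, e2, e3]
  -- the three two-world inequalities on the argmax families, and the mass bounds
  have a13 := hI13a Q2
  have a12 := hI12a Q3
  have b23 : Q23 * (md2 + md3 + (∑ i ∈ Q2, pd i + ∑ i ∈ Q3, pd i)) ≤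
      Qd * (m23_23 + (∑ i ∈ Q2, p23 i + ∑ i ∈ Q3, p23 i)) := by
    have := hI23b (Q2 ∪ Q3)
    rwa [Finset.sum_union hdis, Finset.sum_union hdis] at this
  have t13 := hT13 Q2
  have t12 := hT12 Q3
  have t23 : m23_23 + (∑ i ∈ Q2, p23 i + ∑ i ∈ Q3, p23 i) ≤ Q23 := by
    have := hT23 (Q2 ∪ Q3); rwa [Finset.sum_union hdis] at this
  have td : md2 + md3 + (∑ i ∈ Q2, pd i + ∑ i ∈ Q3, pd i) ≤ Qd := by
    have := hTd (Q2 ∪ Q3); rwa [Finset.sum_union hdis] at this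
  -- aggregated pocket masses (names)
  set Pd2 := ∑ i ∈ Q2, pd i with hPd2
  set Pd3 := ∑ i ∈ Q3, pd i with hPd3
  set P13 := ∑ i ∈ Q2, p13 i with hP13
  set P12 := ∑ i ∈ Q3, p12 i with hP12
  set P23_2 := ∑ i ∈ Q2, p23 i with hP23_2
  set P23_3 := ∑ i ∈ Q3, p23 i with hP23_3
  have nPd2 : 0 ≤ Pd2 := Finset.sum_nonneg fun i _ => hpd i
  have nPd3 : 0 ≤ Pd3 := Finset.sum_nonneg fun i _ => hpd i
  have nP13 : 0 ≤ P13 := Finset.sum_nonneg fun i _ => hp13 i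
  have nP12 : 0 ≤ P12 := Finset.sum_nonneg fun i _ => hp12 i
  have nP23_2 : 0 ≤ P23_2 := Finset.sum_nonneg fun i _ => hp23 i
  have nP23_3 : 0 ≤ P23_3 := Finset.sum_nonneg fun i _ => hp23 i
  rcases hQd.eq_or_lt with hQd0 | hQdpos
  · -- the world `d` is null: its cells vanish, and two glued worlds are null as well
    have zmd2 : md2 = 0 := by linarith
    have zmd3 : md3 = 0 := by linarith
    have zPd2 : Pd2 = 0 := by linarith
    have zPd3 : Pd3 = 0 := by linarith
    rcases hdeg hQd0.symm with ⟨h12, h13⟩ | ⟨h12, h23⟩ | ⟨h13, h23⟩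
    · have z1 : m13_2 = 0 := by linarith
      have z2 : P13 = 0 := by linarith
      have z3 : m12_3 = 0 := by linarith
      have z4 : P12 = 0 := by linarith
      rw [zmd2, zmd3, zPd2, zPd3, z1, z2, z3, z4]
      have g1 := mul_nonneg hδ hm23_23
      have g2 := mul_nonneg hδ nP23_2
      have g3 := mul_nonneg hδ nP23_3
      ring_nf at g1 g2 g3 ⊢
      linarith
    · have z3 : m12_3 = 0 := by linarith
      have z4 : P12 = 0 := by linarith
      have z5 : m23_23 = 0 := by linarith
      have z6 : P23_2 = 0 := by linarith
      have z7 : P23_3 = 0 := by linarith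
      rw [zmd2, zmd3, zPd2, zPd3, z3, z4, z5, z6, z7]
      rcases hQ13.eq_or_lt with hQ130 | hQ13pos
      · have z1 : m13_2 = 0 := by linarith
        have z2 : P13 = 0 := by linarith
        rw [z1, z2]; simp
      · have hQγ : Q13 * γ ≤ 0 := by rw [← hQd0, h23] at H2; linarith
        have hγ : γ ≤ 0 := by
          by_contra h
          exact absurd hQγ (not_le.2 (mul_pos hQ13pos (lt_of_not_ge h)))
        have g1 := mul_nonpos_of_nonpos_of_nonneg hγ hm13_2
        have g2 := mul_nonpos_of_nonpos_of_nonneg hγ nP13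
        ring_nf at g1 g2 ⊢
        linarith
    · have z1 : m13_2 = 0 := by linarith
      have z2 : P13 = 0 := by linarith
      have z5 : m23_23 = 0 := by linarith
      have z6 : P23_2 = 0 := by linarith
      have z7 : P23_3 = 0 := by linarith
      rw [zmd2, zmd3, zPd2, zPd3, z1, z2, z5, z6, z7]
      rcases hQ12.eq_or_lt with hQ120 | hQ12pos
      · have z3 : m12_3 = 0 := by linarith
        have z4 : P12 = 0 := by linarith
        rw [z3, z4]; simp
      · have hQε : Q12 * ε ≤ 0 := by rw [← hQd0, h23] at H3; linarith
        have hε : ε ≤ 0 := by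
          by_contra h
          exact absurd hQε (not_le.2 (mul_pos hQ12pos (lt_of_not_ge h)))
        have g1 := mul_nonpos_of_nonpos_of_nonneg hε hm12_3
        have g2 := mul_nonpos_of_nonpos_of_nonneg hε nP12
        ring_nf at g1 g2 ⊢
        linarith
  · -- main case `Q_d > 0`: show `Q_d · slack ≥ 0`
    refine nonneg_of_mul_pos hQdpos ?_
    have gbound : Qd * (γ * (m13_2 + P13)) ≤ (Qd * α + Q23 * δ) * (md2 + Pd2) := by
      rcases le_or_gt γ 0 with hγ | hγ
      · have h1 : Qd * (γ * (m13_2 + P13)) ≤ 0 :=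
          mul_nonpos_of_nonneg_of_nonpos hQd (mul_nonpos_of_nonpos_of_nonneg hγ (by linarith))
        have h2 : 0 ≤ (Qd * α + Q23 * δ) * (md2 + Pd2) :=
          mul_nonneg (add_nonneg (mul_nonneg hQd hα) (mul_nonneg hQ23 hδ)) (add_nonneg hmd2 nPd2)
        linarith
      · have h1 : γ * (Qd * (m13_2 + P13)) ≤ γ * (Q13 * (md2 + Pd2)) := mul_le_mul_of_nonneg_left a13 hγ.le
        have h2 : (md2 + Pd2) * (Q13 * γ) ≤ (md2 + Pd2) * (Qd * α + Q23 * δ) :=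
          mul_le_mul_of_nonneg_left H2 (add_nonneg hmd2 nPd2)
        ring_nf at h1 h2 ⊢
        linarith
    have ebound : Qd * (ε * (m12_3 + P12)) ≤ (Qd * (α + β) + Q23 * δ) * (md3 + Pd3) := by
      rcases le_or_gt ε 0 with hε | hε
      · have h1 : Qd * (ε * (m12_3 + P12)) ≤ 0 :=
          mul_nonpos_of_nonneg_of_nonpos hQd (mul_nonpos_of_nonpos_of_nonneg hε (by linarith))
        have h2 : 0 ≤ (Qd * (α + β) + Q23 * δ) * (md3 + Pd3) :=
          mul_nonneg (add_nonneg (mul_nonneg hQd (add_nonneg hα hβ)) (mul_nonneg hQ23 hδ)) (add_nonneg hmd3 nPd3)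
        linarith
      · have h1 : ε * (Qd * (m12_3 + P12)) ≤ ε * (Q12 * (md3 + Pd3)) := mul_le_mul_of_nonneg_left a12 hε.le
        have h2 : (md3 + Pd3) * (Q12 * ε) ≤ (md3 + Pd3) * (Qd * (α + β) + Q23 * δ) :=
          mul_le_mul_of_nonneg_left H3 (add_nonneg hmd3 nPd3)
        ring_nf at h1 h2 ⊢
        linarith
    have dbound : δ * (Q23 * (md2 + md3 + (Pd2 + Pd3))) ≤ δ * (Qd * (m23_23 + (P23_2 + P23_3))) :=
      mul_le_mul_of_nonneg_left b23 hδ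
    ring_nf at gbound ebound dbound ⊢
    linarith

end CaseLow

end KNGoodR3

end Summit.CriticalPhenomena.PercolationContinuityZ3.Theorems
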